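import Mathlib.LinearAlgebra.Matrix.Kronecker
import Mathlib.LinearAlgebra.Matrix.Rank
import Mathlib.LinearAlgebra.Matrix.GeneralLinearGroup.Defs
import Literature.Computability.Complexity.PEAToPED
import HarnessLib

/-!
# Route SzkEntropy, crux `PeaThreeNotInP` (stmt-PneNP-10776), line `SketchIdeator3`: objects of the
# tensor-isomorphism line (definitions only)

Objects posited by the line `SketchIdeator3` (card `tensor-iso-monoid-import`, merged with the sparse
orbit-map presentation of card `tensor-orbit-two-query`) for the crux `SzkEntropy.PeaThreeNotInP`
(`PEA 3 ∉ PromiseP`).  The line certifies the reduction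

  3-Tensor Isomorphism over `F₂` (non-isomorphic side promised concise)  `≤ₚ PED 4 ≤_Cook PEA 4 ≤ₚ PEA 3`,

hence `TensorIso ∉ PromiseP → PeaThreeNotInP`; the registered stubs of the skeleton
`Cruxes/PeaThreeNotInP/Lines/SketchIdeator3.lean` are stated in exactly this vocabulary and namespace.

* §1 `Tensor3 a b c` (first flattening `a × (b·c)` of an `a × b × c` tensor over `F₂`), `Triple a b c`
  (ALL matrix triples, not only invertible ones), the trilinear action `tensorAct`, `Iso` (isomorphism
  under `GL_a × GL_b × GL_c`), the other two flattenings `flat₂`, `flat₃`, `Concise` (all three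
  flattening ranks full), `IsUnitTriple`.
* §2 the monoid-randomised samplers `sampler T : M ↦ M·T`, the fair mixture `mixSampler S T`, their
  output entropies `samplerEntropy`, `mixEntropy` (`mapEntropy` over the uniform distribution).
* §3 the SPARSE presentation as route objects (`PolyMapF2`): variables = the `a² + b² + c²` matrix
  entries (`varA/varB/varC`, read back by `readTriple`), `orbitMap T` (output `(i,(j,k))` = one cubic
  monomial `A i i' · B j j' · C k k'` per support point `(i',(j',k'))` of `T`), `flattenList`, the
  degree-4 mixture map `mixMap S T` (selector variable `Fin.last`), iterated direct products `powMap`,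
  and the two halves `pedP S T` (128 mixture copies), `pedQ S T` (64 + 64 plain copies and one fresh
  bit) of the `PED 4` instance.
* §4 instances `TIInst` (three dimensions, two support lists), `TIInst.encoding`, `ofSupport`, the
  promise problem `TensorIso` (YES: isomorphic pairs; NO: CONCISE non-isomorphic pairs — conciseness
  cores are polynomial-time computable, so hardness of this problem is print-equivalent to hardness of
  `TI_{F₂}`), and the instance map `pedOf : TIInst → PEDInst`.

Definitions only (no facts asserted).  Sources: Z. Dvir, D. Gutfreund, G. N. Rothblum, S. Vadhan,
*On approximating the entropy of polynomial mappings*, ICS 2011, §3 (PED/PEA, products);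
J. A. Grochow, Y. Qiao, *On the complexity of isomorphism problems for tensors, groups, and
polynomials I*, SIAM J. Comput. 52 (2023) (3-TI, conciseness); O. Goldreich, S. Micali,
A. Wigderson, J. ACM 38 (1991) (the isomorphism sampler this smears); the cards
`Cruxes/PeaThreeNotInP/Ideas/tensor-iso-monoid-import.md`, `…/tensor-orbit-two-query.md`.
-/

noncomputable section

open Finset
open scoped Kronecker
open Matrix
open _root_.Computability
open Literature.InformationTheory.Entropy
open Literature.Computability.Complexity

namespace Summit.PneNP.PneNP.Cruxes.PeaThreeNotInP.TensorIsoLine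

set_option linter.dupNamespace false -- `Summit.PneNP.PneNP.…`: summit = sub-problem name (D-0017 single-conjunct layout)

/-! ### §1 Tensors, the trilinear monoid action, isomorphism, conciseness -/

/-- A 3-tensor of format `a × b × c` over `F₂`, presented by its first flattening `T_{i,(j,k)}`
(an `a × (b·c)` matrix). [GrochowQiao2023, §2] -/
abbrev Tensor3 (a b c : ℕ) : Type := Matrix (Fin a) (Fin b × Fin c) (ZMod 2)

/-- A triple of square matrices of sizes `a, b, c` over `F₂` — the sample space of the
monoid-randomised sampler (ALL matrices, invertible or not). [folklore] -/
abbrev Triple (a b c : ℕ) : Type :=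
  Matrix (Fin a) (Fin a) (ZMod 2) × Matrix (Fin b) (Fin b) (ZMod 2) × Matrix (Fin c) (Fin c) (ZMod 2)

variable {a b c : ℕ}

/-- The trilinear action `(A,B,C)·T := A · T · (B ⊗ C)ᵀ`, entrywise
`((A,B,C)·T)_{i,(j,k)} = ∑_{i',j',k'} A_{i i'} B_{j j'} C_{k k'} T_{i',(j',k')}` (degree exactly `3` in
the matrix entries). [GrochowQiao2023, §2] -/
def tensorAct (M : Triple a b c) (T : Tensor3 a b c) : Tensor3 a b c :=
  M.1 * T * (M.2.1 ⊗ₖ M.2.2)ᵀ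

/-- Isomorphism of 3-tensors under `GL_a(F₂) × GL_b(F₂) × GL_c(F₂)`: `S = g·T` for a triple of
invertible matrices. [GrochowQiao2023, Def. 1.1 (3-Tensor Isomorphism)] -/
def Iso (S T : Tensor3 a b c) : Prop :=
  ∃ g : Triple a b c, IsUnit g.1 ∧ IsUnit g.2.1 ∧ IsUnit g.2.2 ∧ S = tensorAct g T

/-- The second flattening `T_{j,(i,k)}` (a `b × (a·c)` matrix). [GrochowQiao2023, §2] -/
def flat₂ (T : Tensor3 a b c) : Matrix (Fin b) (Fin a × Fin c) (ZMod 2) :=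
  Matrix.of fun j p => T p.1 (j, p.2)

/-- The third flattening `T_{k,(i,j)}` (a `c × (a·b)` matrix). [GrochowQiao2023, §2] -/
def flat₃ (T : Tensor3 a b c) : Matrix (Fin c) (Fin a × Fin b) (ZMod 2) :=
  Matrix.of fun k p => T p.1 (p.2, k)

/-- A tensor is CONCISE (nondegenerate) if all three flattenings have full row rank `a`, `b`, `c`.
[GrochowQiao2023, §2 (nondegenerate tensors)] -/
def Concise (T : Tensor3 a b c) : Prop :=
  T.rank = a ∧ (flat₂ T).rank = b ∧ (flat₃ T).rank = c

/-- All three matrices of the triple are invertible. [folklore] -/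
def IsUnitTriple (M : Triple a b c) : Prop :=
  IsUnit M.1 ∧ IsUnit M.2.1 ∧ IsUnit M.2.2

/-! ### §2 The monoid-randomised samplers and their entropies -/

/-- The monoid-randomised sampler of `T`: `M ↦ M·T`, `M` uniform over ALL triples. [folklore] -/
def sampler (T : Tensor3 a b c) : Triple a b c → Tensor3 a b c :=
  fun M => tensorAct M T

/-- The fair mixture of the two samplers: `(bit, M) ↦ M·S` if the bit is set, `M·T` otherwise.
[folklore] -/
def mixSampler (S T : Tensor3 a b c) : Bool × Triple a b c → Tensor3 a b c :=
  fun p => if p.1 then tensorAct p.2 S else tensorAct p.2 T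

/-- Output entropy (bits) of the sampler of `T` on a uniform triple. [folklore] -/
def samplerEntropy (T : Tensor3 a b c) : ℝ :=
  mapEntropy (Finset.univ : Finset (Triple a b c)) (sampler T)

/-- Output entropy (bits) of the fair mixture of the samplers of `S` and `T`. [folklore] -/
def mixEntropy (S T : Tensor3 a b c) : ℝ :=
  mapEntropy (Finset.univ : Finset (Bool × Triple a b c)) (mixSampler S T)

/-! ### §3 The sparse presentation: orbit map, mixture map, products, the `PED 4` instance -/

/-- Number of variables of one smearing block: the entries of `A`, `B`, `C`. [folklore] -/
abbrev nvars (a b c : ℕ) : ℕ := a * a + b * b + c * c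

/-- Variable index of the entry `A i i'` (first block). [folklore] -/
def varA (i i' : Fin a) : Fin (nvars a b c) :=
  Fin.castAdd (c * c) (Fin.castAdd (b * b) (finProdFinEquiv (i, i')))

/-- Variable index of the entry `B j j'` (second block). [folklore] -/
def varB (j j' : Fin b) : Fin (nvars a b c) :=
  Fin.castAdd (c * c) (Fin.natAdd (a * a) (finProdFinEquiv (j, j')))

/-- Variable index of the entry `C k k'` (third block). [folklore] -/
def varC (k k' : Fin c) : Fin (nvars a b c) :=
  Fin.natAdd (a * a + b * b) (finProdFinEquiv (k, k'))

/-- The matrix triple read off a valuation of the `a² + b² + c²` variables. [folklore] -/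
def readTriple (v : Fin (nvars a b c) → ZMod 2) : Triple a b c :=
  (Matrix.of fun i i' => v (varA i i'), Matrix.of fun j j' => v (varB j j'),
    Matrix.of fun k k' => v (varC k k'))

/-- The output positions `(i,(j,k))` in the fixed (lexicographic) order. [folklore] -/
def outIdx (a b c : ℕ) : List (Fin a × (Fin b × Fin c)) :=
  (List.finRange a) ×ˢ ((List.finRange b) ×ˢ (List.finRange c))

/-- The support of `T`, listed in the order of `outIdx`. [folklore] -/
def suppList (T : Tensor3 a b c) : List (Fin a × (Fin b × Fin c)) :=
  (outIdx a b c).filter fun p => T p.1 p.2 = 1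

/-- The cubic monomial `A i i' · B j j' · C k k'` attached to output `o = (i,(j,k))` and support point
`p = (i',(j',k'))`. [folklore] -/
def mono (o p : Fin a × (Fin b × Fin c)) : List (Fin (nvars a b c)) :=
  [varA o.1 p.1, varB o.2.1 p.2.1, varC o.2.2 p.2.2]

/-- **The smeared orbit map of `T` as a SPARSE CUBIC MAP** `F₂^{a²+b²+c²} → F₂^{abc}`: output
`(i,(j,k))` is the polynomial `∑_{(i',(j',k')) ∈ supp T} A_{i i'} B_{j j'} C_{k k'}`, i.e. the entry
`(M·T)_{i,(j,k)}` as a function of the entries of `M = (A,B,C)`. [card tensor-orbit-two-query] -/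
def orbitMap (T : Tensor3 a b c) : PolyMapF2 (nvars a b c) :=
  (outIdx a b c).map fun o => (suppList T).map (mono o)

/-- The entries of a tensor listed in the order of `outIdx` (the shape of `PolyMapF2.eval` outputs).
[folklore] -/
def flattenList (U : Tensor3 a b c) : List (ZMod 2) :=
  (outIdx a b c).map fun o => U o.1 o.2

/-- **The mixture map** on `a² + b² + c² + 1` variables (selector variable `Fin.last`): output
`(i,(j,k))` is `(M·T)_{i,(j,k)} + sel · (M·(S+T))_{i,(j,k)}`, which over `F₂` is `(M·S)_{i,(j,k)}` when
`sel = 1` and `(M·T)_{i,(j,k)}` when `sel = 0`; degree `4`. [card tensor-iso-monoid-import] -/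
def mixMap (S T : Tensor3 a b c) : PolyMapF2 (nvars a b c + 1) :=
  (outIdx a b c).map fun o =>
    ((suppList T).map fun p => (mono o p).map Fin.castSucc) ++
      ((suppList (S + T)).map fun p => Fin.last (nvars a b c) :: (mono o p).map Fin.castSucc)

/-- Iterated direct product `P^{×t}` on `n·t` variables (`t` independent copies of `P`,
`powMap P (t+1) = (powMap P t).prod P`). [DvirGutfreundRothblumVadhan2010, §3 p.6 (`pᵗ`)] -/
def powMap {n : ℕ} (P : PolyMapF2 n) : (t : ℕ) → PolyMapF2 (n * t)
  | 0 => []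
  | t + 1 => (powMap P t).prod P

/-- The first map of the `PED 4` instance: `128` independent copies of the mixture map.
[card tensor-iso-monoid-import] -/
def pedP (S T : Tensor3 a b c) : Σ n : ℕ, PolyMapF2 n :=
  ⟨(nvars a b c + 1) * 128, powMap (mixMap S T) 128⟩

/-- The second map of the `PED 4` instance: `64` copies of the orbit map of `S`, `64` of that of `T`,
and one fresh variable output as is (`idMap 1`). [card tensor-iso-monoid-import] -/
def pedQ (S T : Tensor3 a b c) : Σ n : ℕ, PolyMapF2 n :=
  ⟨nvars a b c * 64 + (nvars a b c * 64 + 1),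
    (powMap (orbitMap S) 64).prod ((powMap (orbitMap T) 64).prod (PolyMapF2.idMap 1))⟩

/-! ### §4 Instances, the promise problem `TensorIso`, the instance map -/

/-- Instances of 3-TENSOR ISOMORPHISM over `F₂`: dimensions `a, b, c` and two tensors of format
`a × b × c` given by support lists. [GrochowQiao2023, Def. 1.1] -/
abbrev TIInst : Type :=
  Σ a : ℕ, Σ b : ℕ, Σ c : ℕ, List (Fin a × (Fin b × Fin c)) × List (Fin a × (Fin b × Fin c))

/-- Boolean code of an index triple `(i,(j,k))` (binary numerals, paired). [AroraBarak2009, §0.1] -/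
def tripleEncoding (a b c : ℕ) : Encoding (Fin a × (Fin b × Fin c)) Bool :=
  (encodingFinBool a).pairBool ((encodingFinBool b).pairBool (encodingFinBool c))

/-- Boolean code of TI instances: `a`, `b`, `c` in binary, then the pair of the two support lists.
[AroraBarak2009, §0.1] -/
def TIInst.encoding : Encoding TIInst Bool :=
  Encoding.sigmaBool fun a => Encoding.sigmaBool fun b => Encoding.sigmaBool fun c =>
    (tripleEncoding a b c).listBool.pairBool (tripleEncoding a b c).listBool

/-- The `0/1` tensor with the given support (membership; order and repetitions irrelevant).
[folklore] -/
def ofSupport (L : List (Fin a × (Fin b × Fin c))) : Tensor3 a b c :=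
  Matrix.of fun i jk => if (i, jk) ∈ L then 1 else 0

/-- The first tensor of an instance. [folklore] -/
def TIInst.fstT (I : TIInst) : Tensor3 I.1 I.2.1 I.2.2.1 :=
  ofSupport I.2.2.2.1

/-- The second tensor of an instance. [folklore] -/
def TIInst.sndT (I : TIInst) : Tensor3 I.1 I.2.1 I.2.2.1 :=
  ofSupport I.2.2.2.2

/-- **3-TENSOR ISOMORPHISM over `F₂`** as a promise problem: YES = isomorphic pairs, NO =
non-isomorphic pairs of CONCISE tensors.  (Every tensor has a polynomial-time computable concise core
and two tensors are isomorphic iff their cores have equal formats and are isomorphic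
[GrochowQiao2023, §2], so a polynomial-time algorithm for this promise problem decides `TI_{F₂}` and
conversely; the line's transfer hypothesis is `TensorIso ∉ PromiseP`.) [GrochowQiao2023, Def. 1.1] -/
def TensorIso : PromiseProblem :=
  PromiseProblem.ofEncoding TIInst.encoding
    {I | Iso I.fstT I.sndT}
    {I | Concise I.fstT ∧ Concise I.sndT ∧ ¬ Iso I.fstT I.sndT}

/-- **The instance map** `(S, T) ↦ (pedP S T, pedQ S T)` into `PED 4`. [card tensor-iso-monoid-import] -/
def pedOf (I : TIInst) : PEDInst :=
  (pedP I.fstT I.sndT, pedQ I.fstT I.sndT)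

/-! ### §5 The guarded instance map (polynomial output length)

The formats `a, b, c` are coded in BINARY while a tensor is given by its support list, so
`pedOf` (with its `a·b·c` output polynomials per copy) has super-polynomial output length on
short-support instances of large format; such instances are never concise (a rank is at most the
number of support points), hence never NO-instances of `TensorIso`, and the reduction may send
them to a fixed NO instance of `PED`.  The guard compares the formats with the length of the
first support list, which also serves as the unary loop budget of the `CodeFP` program. -/

/-- The syntactic guard: all three formats are at most the length of the first support list
(implied by conciseness of the first tensor). [folklore] -/
def guardOK (I : TIInst) : Bool :=
  decide (I.1 ≤ I.2.2.2.1.length) && (decide (I.2.1 ≤ I.2.2.2.1.length) &&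
    decide (I.2.2.1 ≤ I.2.2.2.1.length))

/-- **The guarded instance map** `TIInst → PEDInst`: `pedOf` under the guard, otherwise the fixed
NO instance `PEAToPED.noInst` of `PED d` (`d ≥ 1`). [card tensor-iso-monoid-import] -/
def pedOfG (I : TIInst) : PEDInst :=
  if guardOK I then pedOf I else PEAToPED.noInst

end Summit.PneNP.PneNP.Cruxes.PeaThreeNotInP.TensorIsoLine

end
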